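import Summits.BirchSwinnertonDyer.BirchSwinnertonDyer.Theorems.ResidualThetaTransportAtTwoResidualSignedLambdaLowerCMAtTwoImprimitiveDuality
import Literature.NumberTheory.EllipticCurves.Kato2004.IwasawaCohomologyCoeff
import Literature.NumberTheory.GaloisRepresentations.ContinuousH1AddHomAlgebraProofs
import HarnessLib

/-!
# stub-ideation k1 · gen 9 — `stub_cmLambdaLower` (RSL_g, stmt-22608) on crux (R≥)ᵖ (stmt-26074):
# the PLACE-SEPARATING CUT of the registered port `stub_deepHalfRelaxed` (S4rel, element form) /
# `stub_singularCorank` (S4λ, corank form)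

Seat `planner-sidea-stub_cmLambdaLower-1-g9` (technique family: weaken / strengthen — weakest sufficient forms).
HONEST FRAMING: nothing here proves S2, RSL_g (22608), the crux 26074, or BSD; no `sorry`; no route / registry writes.
The skeleton `Lines/bt26_lambda.lean` (v6) and the lead's v2 cut (SKELETON-V2-CUT-g16: S1⊕ / S2 / S3 / S4rel / EH_Z, `_of`
via `LambdaLowerBoundO.cmLambdaLower_of_dualityData_onePair`) are NOT touched; the stub statement is never re-typed.

WHAT IS HERE.
* §A (PROVED, abstract carriers): the port `DeepHalfRelaxed` (pairs `(z, χ) ∈ 𝔉₂ × P_{S₀}`) is EQUIVALENT, modulo three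
  cheap identities, to the conjunction of two statements each WEAKER than it and each living at ONE kind of place:
  `AtTwoBlock` (the `χ = 0` slice: a functional at `2` killing `loc₂(SelRel)` is `locd₂` of an `S₀`-STRICT family —
  no `S₀`-carriers) and `AwayBlock` (a functional at `S₀` killing `loc_{S₀}` of the STRICT-AT-2 classes is `locd_{S₀}`
  of a family — no `2`-adic carriers): `deepHalfRelaxed_of_blocks` (⟸, the useful direction, from `Reciprocity` +
  `StrictKilled`) and `atTwoBlock_of_deepHalfRelaxed` / `awayBlock_of_deepHalfRelaxed` (⟹, from `StrictKilled` /
  an extension hypothesis).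
* §B (PROVED, abstract λ-currency): `finrank_baseChange_quotient_map_eq_add`
  (`λ(Λ/𝒸 H_str) = λ(𝐇¹/H_str) + λ(Λ/𝒸 𝐇¹)` for injective `𝒸`) and the corank-road glue `add_finrank_le_of_placeCut`
  (`Σ + λ(Λ/𝒸 𝐇¹) ≤ λ(Sg⋆)` — literally the conclusion of rev 10's S4λ — from the two block inequalities along the flag
  `Fine ≤ Str₂ ≤ Sg`, reusing `CharIdealLambda.finrank_baseChange_characterModule_eq_add_quotient` BY NAME; the defect
  `τ = λ(𝐇¹/H_str)` CANCELS).
* §C (TYPED over the tree): the `S₀`-strictness predicate `IsStrictAt I S₀ x` for `x : I.H`,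
  `I : Kato2004.IwasawaH1DataCoeff T 2 κ γ` (decomposition groups = stabilisers of `𝔓 ∈ w.primesAbove`, as in the
  tree's `Kato2004.IsLocallyTrivialAt`), `IsStrictAt.res_inertia_eq_zero` (strict ⇒ unramified, via Mathlib
  `Ideal.inertia_le_stabilizer` + `resLe_resLe_apply`), its additive subgroup `strictFamilies`, and the typed block
  `AtTwoBlockAt` with the bridge `atTwoBlock_of_atTwoBlockAt` to §A.
-/

set_option autoImplicit false
-- the Cruxes namespace of this sub repeats the summit name by design (D-0017 nested layout)
set_option linter.dupNamespace false

noncomputable section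

open scoped TensorProduct Pointwise NumberField

namespace Summit.BirchSwinnertonDyer.BirchSwinnertonDyer.Cruxes.ResidualThetaCountLowerPureAtTwo.StubIdeasK1G9

/-! ## §A Element-level glue: `S4rel ⟸ S4⁺ ∧ S4⁰ ∧ EH` (PROVED, abstract carriers) -/

section ElementGlue

variable {R : Type*} [CommRing R] [NoZeroDivisors R]
  {H : Type*} [AddCommGroup H] [Module R H]   -- compact global carrier (`I.H = 𝐇¹(T_ρ)`)
  {F : Type*} [AddCommGroup F] [Module R F]   -- functionals at `2` (`𝔉₂`, currency (C3))
  {P : Type*} [AddCommGroup P] [Module R P]   -- functionals at `S₀` (`P_{S₀} = ⊕ D_w⋆`, currency (C5))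
  {S : Type*} [AddCommGroup S] [Module R S]   -- discrete test classes (`SelRel`, currency (C4))
  {Q : Type*} [AddCommGroup Q] [Module R Q]   -- values of the local pairings
  (ld₂ : H →ₗ[R] F) (ldS : H →ₗ[R] P) (ev₂ : F →ₗ[R] S →ₗ[R] Q) (evS : P →ₗ[R] S →ₗ[R] Q)
  (Str : Submodule R S)                        -- the strict-at-`2` test classes (`SelRel ⊓ StrictAtTwo`)

/-- The registered port, element form (the lead's `stub_deepHalfRelaxed`, abstract carriers): a pair
`t = (z, χ) ∈ 𝔉₂ × P_{S₀}` orthogonal to `loc(SelRel)` is, up to a non-zero scalar, `locd` of a global family. -/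
def DeepHalfRelaxed : Prop :=
  ∀ (z : F) (χ : P), (∀ s : S, ev₂ z s + evS χ s = 0) →
    ∃ a : R, a ≠ 0 ∧ ∃ x : H, a • z = ld₂ x ∧ a • χ = ldS x

/-- **S4₂ — the AT-2 block** (= the `χ = 0` slice of the port; no `S₀`-carriers): a functional at `2` killing
`loc₂(SelRel)` is, up to a non-zero scalar, `locd₂` of a global family whose `S₀`-component VANISHES. -/
def AtTwoBlock : Prop :=
  ∀ z : F, (∀ s : S, ev₂ z s = 0) → ∃ a : R, a ≠ 0 ∧ ∃ x : H, ldS x = 0 ∧ a • z = ld₂ x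

/-- **S4₀ — the AWAY-FROM-2 block** (test space cut down to the strict-at-`2` classes; no `2`-adic data): a functional
at `S₀` killing `loc_{S₀}` of the STRICT-AT-2 classes is, up to a non-zero scalar, `locd_{S₀}` of a global family. -/
def AwayBlock : Prop :=
  ∀ χ : P, (∀ s ∈ Str, evS χ s = 0) → ∃ a : R, a ≠ 0 ∧ ∃ x : H, a • χ = ldS x

/-- **EH — the easy half (reciprocity)** for EVERY global family (⊇ the lead's `EH_Z` for `z_g`). -/
def Reciprocity : Prop :=
  ∀ (x : H) (s : S), ev₂ (ld₂ x) s + evS (ldS x) s = 0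

/-- Functionals at `2` see only `loc₂`: they kill the strict-at-`2` classes (definitional on the real carriers). -/
def StrictKilled : Prop :=
  ∀ (z : F), ∀ s ∈ Str, ev₂ z s = 0

/-- **THE GLUE (⟸).** `S4rel ⟸ S4₂ ∧ S4₀ ∧ EH ∧ StrictKilled`: restrict `(z, χ)` to the strict classes (S4₀ gives
`a₀ χ = ldS x₀`), correct `z` by `x₀` using reciprocity, apply S4₂ to `a₀ z − ld₂ x₀`, recombine. -/
theorem deepHalfRelaxed_of_blocks (hStr : StrictKilled ev₂ Str) (hEH : Reciprocity ld₂ ldS ev₂ evS)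
    (hplus : AtTwoBlock ld₂ ldS ev₂) (hzero : AwayBlock ldS evS Str) :
    DeepHalfRelaxed ld₂ ldS ev₂ evS := by
  intro z χ hzχ
  have hχ : ∀ s ∈ Str, evS χ s = 0 := fun s hs ↦ by simpa [hStr z s hs] using hzχ s
  obtain ⟨a₀, ha₀, x₀, hx₀⟩ := hzero χ hχ
  have hz' : ∀ s : S, ev₂ (a₀ • z - ld₂ x₀) s = 0 := by
    intro s
    have h3 : ev₂ z s = -evS χ s := eq_neg_of_add_eq_zero_left (hzχ s)
    have h4 : ev₂ (ld₂ x₀) s = -(a₀ • evS χ s) := by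
      have h2 := hEH x₀ s
      rw [← hx₀, map_smul, LinearMap.smul_apply] at h2
      exact eq_neg_of_add_eq_zero_left h2
    rw [map_sub, LinearMap.sub_apply, map_smul, LinearMap.smul_apply, h3, h4, smul_neg, sub_neg_eq_add,
      neg_add_cancel]
  obtain ⟨a₁, ha₁, x₁, hx₁S, hx₁⟩ := hplus _ hz'
  refine ⟨a₁ * a₀, mul_ne_zero ha₁ ha₀, a₁ • x₀ + x₁, ?_, ?_⟩
  · rw [mul_smul, map_add, map_smul, ← hx₁, smul_sub, add_sub_cancel]
  · rw [mul_smul, hx₀, map_add, map_smul, hx₁S, add_zero]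

omit [NoZeroDivisors R] in
/-- **(⟹, at 2).** The port gives back the at-`2` block on the nose: it IS the `χ = 0` slice. -/
theorem atTwoBlock_of_deepHalfRelaxed (h : DeepHalfRelaxed ld₂ ldS ev₂ evS) : AtTwoBlock ld₂ ldS ev₂ := by
  intro z hz
  obtain ⟨a, ha, x, hzx, hx⟩ := h z 0 fun s ↦ by rw [hz s, map_zero, LinearMap.zero_apply, add_zero]
  exact ⟨a, ha, x, by rw [← hx, smul_zero], hzx⟩

omit [NoZeroDivisors R] in
/-- **(⟹, away from 2).** The port plus an EXTENSION hypothesis (a functional on `loc₂(SelRel)` — here `s ↦ −χ(loc_S s)`,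
which vanishes on the strict classes — extends to some `z ∈ 𝔉₂`; levelwise this is `ℤ/2^k` self-injective) gives the
away block. So modulo `StrictKilled`, `Reciprocity` and `Extends` the cut is an EQUIVALENCE: no strength is added. -/
theorem awayBlock_of_deepHalfRelaxed_of_extends (h : DeepHalfRelaxed ld₂ ldS ev₂ evS)
    (hExt : ∀ χ : P, (∀ s ∈ Str, evS χ s = 0) → ∃ z : F, ∀ s : S, ev₂ z s + evS χ s = 0) :
    AwayBlock ldS evS Str := by
  intro χ hχ
  obtain ⟨z, hz⟩ := hExt χ hχ
  obtain ⟨a, ha, x, -, hx⟩ := h z χ hz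
  exact ⟨a, ha, x, hx⟩

end ElementGlue

/-! ## §B λ-currency glue for the corank road (PROVED, abstract) -/

section LambdaGlue

universe u v w

variable {A : Type u} [CommRing A] (K : Type w) [Field K] [Algebra A K] [IsFractionRing A K]
  {H : Type v} [AddCommGroup H] [Module A H] {L : Type v} [AddCommGroup L] [Module A L]
  (𝒸 : H →ₗ[A] L) (Hstr : Submodule A H)

/-- **`λ(Λ/𝒸(H_str)) = λ(𝐇¹/H_str) + λ(Λ/𝒸(𝐇¹))`** for an injective `𝒸 : 𝐇¹ → Λ` and a submodule `H_str ≤ 𝐇¹`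
(`0 → 𝐇¹/H_str → Λ/𝒸(H_str) → Λ/𝒸(𝐇¹) → 0` and flat base change). [folklore] -/
theorem finrank_baseChange_quotient_map_eq_add (h𝒸 : Function.Injective 𝒸)
    [Module.Finite K (K ⊗[A] (L ⧸ Hstr.map 𝒸))] :
    Module.finrank K (K ⊗[A] (L ⧸ Hstr.map 𝒸)) =
      Module.finrank K (K ⊗[A] (H ⧸ Hstr)) + Module.finrank K (K ⊗[A] (L ⧸ LinearMap.range 𝒸)) := by
  have hle : Hstr.map 𝒸 ≤ (LinearMap.range 𝒸).comap (LinearMap.id : L →ₗ[A] L) := by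
    rw [Submodule.comap_id]; exact LinearMap.map_le_range
  refine Theorems.LambdaLowerBoundO.finrank_baseChange_eq_of_exact_three K
    (Hstr.mapQ (Hstr.map 𝒸) 𝒸 (Submodule.le_comap_map 𝒸 Hstr))
    ((Hstr.map 𝒸).mapQ (LinearMap.range 𝒸) LinearMap.id hle) ?_ ?_ ?_
  · rw [injective_iff_map_eq_zero]
    intro x hx
    induction x using Submodule.Quotient.induction_on with
    | H x =>
      rw [Submodule.mapQ_apply, Submodule.Quotient.mk_eq_zero, Submodule.mem_map] at hx
      obtain ⟨y, hy, hyx⟩ := hx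
      rw [Submodule.Quotient.mk_eq_zero, ← h𝒸 hyx]
      exact hy
  · intro y
    induction y using Submodule.Quotient.induction_on with
    | H l =>
      constructor
      · intro hl
        rw [Submodule.mapQ_apply, LinearMap.id_apply, Submodule.Quotient.mk_eq_zero, LinearMap.mem_range] at hl
        obtain ⟨x, hx⟩ := hl
        exact ⟨Submodule.Quotient.mk x, by rw [Submodule.mapQ_apply, hx]⟩
      · rintro ⟨x, hx⟩
        obtain ⟨x, rfl⟩ := Submodule.Quotient.mk_surjective Hstr x
        rw [Submodule.mapQ_apply, Submodule.Quotient.eq] at hx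
        rw [Submodule.mapQ_apply, LinearMap.id_apply, Submodule.Quotient.mk_eq_zero]
        have : l = 𝒸 x - (𝒸 x - l) := by abel
        rw [this]
        exact sub_mem (LinearMap.mem_range_self 𝒸 x) (LinearMap.map_le_range hx)
  · intro c
    induction c using Submodule.Quotient.induction_on with
    | H l => exact ⟨Submodule.Quotient.mk l, rfl⟩

/-- **Corank-road glue of the sign-isolating cut.** Along a flag `Fine ≤ Str₂ ≤ Sg` of the discrete Selmer module:
block I `λ(Λ/𝒸(H_str)) ≤ λ((Sg/Str₂)⋆)` (sign block) and block II `Σ ≤ λ((Str₂/Fine)⋆) + λ(𝐇¹/H_str)` (away block)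
give the port inequality `Σ + λ(Λ/𝒸(𝐇¹)) ≤ λ(Sg⋆)` — the defect `λ(𝐇¹/H_str)` CANCELS. [folklore] -/
theorem add_finrank_le_of_placeCut {Sg : Type v} [AddCommGroup Sg] [Module A Sg]
    (Str₂ : Submodule A Sg) (Fine : Submodule A Str₂) [Module.Finite K (K ⊗[A] CharacterModule Sg)]
    (h𝒸 : Function.Injective 𝒸) [Module.Finite K (K ⊗[A] (L ⧸ Hstr.map 𝒸))] {σ : ℕ}
    (hI : Module.finrank K (K ⊗[A] (L ⧸ Hstr.map 𝒸)) ≤ Module.finrank K (K ⊗[A] CharacterModule (Sg ⧸ Str₂)))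
    (hII : σ ≤ Module.finrank K (K ⊗[A] CharacterModule (Str₂ ⧸ Fine)) +
      Module.finrank K (K ⊗[A] (H ⧸ Hstr))) :
    σ + Module.finrank K (K ⊗[A] (L ⧸ LinearMap.range 𝒸)) ≤ Module.finrank K (K ⊗[A] CharacterModule Sg) := by
  have h1 := Theorems.CharIdealLambda.finrank_baseChange_characterModule_eq_add_quotient K Str₂
  haveI := Theorems.CharIdealLambda.finite_baseChange_characterModule_submodule K Str₂
  have h2 := Theorems.CharIdealLambda.finrank_baseChange_characterModule_eq_add_quotient K Fine
  have h3 := finrank_baseChange_quotient_map_eq_add K 𝒸 Hstr h𝒸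
  omega

end LambdaGlue

/-! ## §C The `S₀`-strict families of `𝐇¹(T)` and the typed sign block (TYPED over the tree) -/

section Typed

open IsDedekindDomain Field
open Literature.NumberTheory.GaloisRepresentations Literature.NumberTheory.EllipticCurves
  Literature.NumberTheory.EllipticCurves.Kato2004

variable {𝒪 : Type} [CommRing 𝒪] [TopologicalSpace 𝒪] {M : Type} [AddCommGroup M] [Module 𝒪 M]
  [TopologicalSpace M] [IsTopologicalAddGroup M] [ContinuousSMul 𝒪 M]
  {T : GaloisRep ℚ 𝒪 M} {κ : ZpExtension ℚ 2} {γ : absoluteGaloisGroup ℚ}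

/-- **`x ∈ 𝐇¹(T)` is STRICT at `S₀`**: at every layer `ℚ_n` and every prime `𝔓` of `ℤ̄` above a place `w ∈ S₀`,
the restriction of `x_n = I.proj n x` to `Γ_n ∩ D_𝔓` vanishes (`D_𝔓` = the stabiliser of `𝔓`; same typing as the
tree's `Kato2004.IsLocallyTrivialAt`). These are the norm-compatible families in the compact Selmer groups of the
structure "zero at `S₀`" — the dual side of "relaxed at `S₀`" (`relaxed^⊥ = 0`: no `unr^⊥ = unr` anywhere, T13-free). -/
def IsStrictAt (I : IwasawaH1DataCoeff T 2 κ γ) (S₀ : Finset (HeightOneSpectrum (𝓞 ℚ))) (x : I.H) : Prop :=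
  ∀ (n : ℕ), ∀ w ∈ S₀, ∀ 𝔓 ∈ w.primesAbove,
    resLe T.toTopRep
      (inf_le_left : κ.layerSubgroup n ⊓ MulAction.stabilizer (absoluteGaloisGroup ℚ) 𝔓 ≤ κ.layerSubgroup n)
      1 (I.proj n x) = 0

variable (I : IwasawaH1DataCoeff T 2 κ γ) (S₀ : Finset (HeightOneSpectrum (𝓞 ℚ)))

theorem isStrictAt_zero : IsStrictAt I S₀ 0 := fun n w _ 𝔓 _ ↦ by rw [map_zero, map_zero]

variable {I S₀} in
theorem IsStrictAt.add {x y : I.H} (hx : IsStrictAt I S₀ x) (hy : IsStrictAt I S₀ y) :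
    IsStrictAt I S₀ (x + y) := fun n w hw 𝔓 h𝔓 ↦ by
  rw [map_add, map_add, hx n w hw 𝔓 h𝔓, hy n w hw 𝔓 h𝔓, add_zero]

variable {I S₀} in
theorem IsStrictAt.neg {x : I.H} (hx : IsStrictAt I S₀ x) : IsStrictAt I S₀ (-x) := fun n w hw 𝔓 h𝔓 ↦ by
  rw [map_neg, map_neg, hx n w hw 𝔓 h𝔓, neg_zero]

variable {I S₀} in
/-- Shrinking `S₀` relaxes strictness. -/
theorem IsStrictAt.mono {S₁ : Finset (HeightOneSpectrum (𝓞 ℚ))} (h : S₁ ⊆ S₀) {x : I.H} (hx : IsStrictAt I S₀ x) :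
    IsStrictAt I S₁ x := fun n w hw 𝔓 h𝔓 ↦ hx n w (h hw) 𝔓 h𝔓

variable {I S₀} in
/-- **Strict at `w` ⇒ unramified at `w`** (`I_𝔓 ≤ D_𝔓`, Mathlib `Ideal.inertia_le_stabilizer`, and transitivity of
restriction `resLe_resLe_apply`): the `S₀`-strict families need NO purity / Bloch–Kato-volume input to be integral —
they already live in `I.H` (`proj_mem`) and their `S₀`-components vanish identically. -/
theorem IsStrictAt.res_inertia_eq_zero {x : I.H} (hx : IsStrictAt I S₀ x) (n : ℕ)
    {w : HeightOneSpectrum (𝓞 ℚ)} (hw : w ∈ S₀) {𝔓 : Ideal (absIntegers (𝓞 ℚ) ℚ)} (h𝔓 : 𝔓 ∈ w.primesAbove) :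
    resLe T.toTopRep
      (inf_le_left : κ.layerSubgroup n ⊓ 𝔓.inertia (absoluteGaloisGroup ℚ) ≤ κ.layerSubgroup n) 1 (I.proj n x) = 0 := by
  have hle : κ.layerSubgroup n ⊓ 𝔓.inertia (absoluteGaloisGroup ℚ) ≤
      κ.layerSubgroup n ⊓ MulAction.stabilizer (absoluteGaloisGroup ℚ) 𝔓 :=
    inf_le_inf_left _ 𝔓.inertia_le_stabilizer
  have h := resLe_resLe_apply T.toTopRep hle
    (inf_le_left : κ.layerSubgroup n ⊓ MulAction.stabilizer (absoluteGaloisGroup ℚ) 𝔓 ≤ κ.layerSubgroup n)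
    (I.proj n x)
  rw [hx n w hw 𝔓 h𝔓, map_zero] at h
  exact h.symm

/-- **`H_{S₀-str} ⊆ 𝐇¹(T)`**, the additive subgroup of `S₀`-strict families (the compact test object of block I). -/
def strictFamilies : AddSubgroup I.H where
  carrier := {x | IsStrictAt I S₀ x}
  add_mem' hx hy := hx.add hy
  zero_mem' := isStrictAt_zero I S₀
  neg_mem' hx := hx.neg

theorem mem_strictFamilies_iff (x : I.H) : x ∈ strictFamilies I S₀ ↔ IsStrictAt I S₀ x := Iff.rfl

/-- **S4⁺ typed on the compact side**: for ANY scalar ring `R` acting on `𝐇¹(T)` and ANY `R`-linear value map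
`ld₂ : 𝐇¹(T) → 𝔉₂` with test pairing `ev₂` (the lead's (C3) objects, abstract here): a functional at `2` killing the
test classes is, up to `a ≠ 0`, `ld₂` of an `S₀`-STRICT family. -/
def AtTwoBlockAt {R : Type*} [CommRing R] [Module R I.H] {F : Type*} [AddCommGroup F] [Module R F]
    {S : Type*} [AddCommGroup S] [Module R S] {Q : Type*} [AddCommGroup Q] [Module R Q]
    (ld₂ : I.H →ₗ[R] F) (ev₂ : F →ₗ[R] S →ₗ[R] Q) : Prop :=
  ∀ z : F, (∀ s : S, ev₂ z s = 0) → ∃ a : R, a ≠ 0 ∧ ∃ x : I.H, IsStrictAt I S₀ x ∧ a • z = ld₂ x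

variable {I S₀} in
/-- Bridge to §A: once the `S₀`-value map `ldS` is value-pinned (it factors through the `loc_w (I.proj n x)`, so it
vanishes on strict families — hypothesis `hldS`), the typed sign block is the abstract one. -/
theorem atTwoBlock_of_atTwoBlockAt {R : Type*} [CommRing R] [NoZeroDivisors R] [Module R I.H]
    {F : Type*} [AddCommGroup F] [Module R F] {P : Type*} [AddCommGroup P] [Module R P]
    {S : Type*} [AddCommGroup S] [Module R S] {Q : Type*} [AddCommGroup Q] [Module R Q]
    (ld₂ : I.H →ₗ[R] F) (ldS : I.H →ₗ[R] P) (ev₂ : F →ₗ[R] S →ₗ[R] Q)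
    (hldS : ∀ x : I.H, IsStrictAt I S₀ x → ldS x = 0) (h : AtTwoBlockAt I S₀ ld₂ ev₂) :
    AtTwoBlock ld₂ ldS ev₂ := by
  intro z hz
  obtain ⟨a, ha, x, hx, hzx⟩ := h z hz
  exact ⟨a, ha, x, hldS x hx, hzx⟩

end Typed

end Summit.BirchSwinnertonDyer.BirchSwinnertonDyer.Cruxes.ResidualThetaCountLowerPureAtTwo.StubIdeasK1G9
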